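import Mathlib
import Summits.NavierStokesRegularity.NavierStokesRegularity.Theorems.LerayQuarterDissipationFiniteDissipationLiouvilleLocalBalance
import HarnessLib

/-!
# Crux `FiniteDissipationLiouville` (stmt-NavierStokesRegularity-22144): WHERE the local
# enstrophy-production excess of the hypothetical profile sits — in the fast parabolic core

Theorems file of route `LerayQuarterDissipation` (lead prover g18; `--supports` the crux; sequel of
`…LocalBalance`). Navier–Stokes regularity is NOT proved by anything here; no summit is.

`…LocalBalance.localBalance_excess_of_singular`: a singular enveloped member has a space–time point
with `(1+ε)(‖curl ω‖² + ‖ω‖²/(4(−t))) < ⟪u, ω × curl ω⟫`. This file LOCALISES such points, by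
pointwise algebra only:

* `norm_mul_norm_le_sqrt_mul_balance` — `‖ω‖‖curl ω‖ ≤ √(−t)(‖curl ω‖² + ‖ω‖²/(4(−t)))` (AM–GM at the
  parabolic scale), hence `⟪u, ω × curl ω⟫ ≤ √(−t)‖u‖·(‖curl ω‖² + ‖ω‖²/(4(−t)))`;
* `fast_of_localBalance_excess` — at an excess point `√(−t)‖u(t,x)‖ > 1 + ε`: the excess lives in
  the FAST SET (the super-self-similar-speed set of the tree's threshold-one row);
* `core_of_localBalance_excess` — with a Type-I envelope `‖u‖ ≤ A/(‖x‖ + √(−t))` the excess point has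
  `(1+ε)(‖x‖ + √(−t)) < A√(−t)`, i.e. it lies in the parabolic CORE `‖x‖ < (A/(1+ε) − 1)√(−t)` (and
  no excess is possible at all unless `A > 1 + ε`);
* **`localBalance_excess_in_fastCore_of_singular`** — PORTRAIT: the critical element has, for some
  `ε = ε(A) > 0`, a point of local Lamb-form production excess by the factor `1+ε` which is fast
  (`√(−t)‖W‖ > 1+ε`) and central (`(1+ε)(‖x‖+√(−t)) < A√(−t)`).

HONEST FRAMING. Pointwise consequences of the landed portrait clause; necessary conditions on a
HYPOTHETICAL object; nothing is removed from the DSS wall. Nothing here bears on NS regularity.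

References: folklore algebra; Koch–Nadirashvili–Seregin–Šverák (2009) §4 for the class.
-/

noncomputable section

set_option linter.dupNamespace false

namespace Summit.NavierStokesRegularity.NavierStokesRegularity.Theorems.FiniteDissipationLiouville.LocalBalance

open MeasureTheory Set Filter Topology Metric InnerProductSpace Function Real
open scoped RealInnerProductSpace ContDiff
open Literature.Analysis Literature.Analysis.FluidPDE
open Summit.NavierStokesRegularity.NavierStokesRegularity.Theorems
open Summit.NavierStokesRegularity.NavierStokesRegularity.Theorems.FiniteDissipationLiouville
open Summit.NavierStokesRegularity.NavierStokesRegularity.Theorems.FiniteDissipationLiouville.CrossFlow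

variable {C : ℝ} {V : ℝ → EuclideanSpace ℝ (Fin 3) → EuclideanSpace ℝ (Fin 3)}

/-- **AM–GM at the parabolic scale**: for `t < 0` and vectors `a, b`,
`‖a‖‖b‖ ≤ √(−t)(‖b‖² + ‖a‖²/(4(−t)))`. [folklore] -/
theorem norm_mul_norm_le_sqrt_mul_balance {t : ℝ} (ht : t < 0) (a b : EuclideanSpace ℝ (Fin 3)) :
    ‖a‖ * ‖b‖ ≤ Real.sqrt (-t) * (‖b‖ ^ 2 + ‖a‖ ^ 2 / (4 * (-t))) := by
  have ht' : 0 < -t := neg_pos.2 ht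
  set r : ℝ := Real.sqrt (-t) with hr
  have hs : 0 < r := Real.sqrt_pos.2 ht'
  have hss : r * r = -t := Real.mul_self_sqrt ht'.le
  rw [← hss]
  have e : r * (‖b‖ ^ 2 + ‖a‖ ^ 2 / (4 * (r * r))) = (4 * r ^ 2 * ‖b‖ ^ 2 + ‖a‖ ^ 2) / (4 * r) := by
    rw [eq_div_iff (by positivity)]
    field_simp
  rw [e, le_div_iff₀ (by positivity)]
  nlinarith [sq_nonneg (2 * r * ‖b‖ - ‖a‖)]

/-- **The Lamb-form production is at most `√(−t)‖u‖` times the balance density**: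
`⟪V, ω × curl ω⟫ ≤ √(−t)‖V(t,x)‖·(‖curl ω‖² + ‖ω‖²/(4(−t)))`. [folklore] -/
theorem inner_lamb_le_speed_mul_balance {t : ℝ} (ht : t < 0) (v a b : EuclideanSpace ℝ (Fin 3)) :
    ⟪v, cross a b⟫ ≤ Real.sqrt (-t) * ‖v‖ * (‖b‖ ^ 2 + ‖a‖ ^ 2 / (4 * (-t))) := by
  have h1 : ⟪v, cross a b⟫ ≤ ‖v‖ * (‖a‖ * ‖b‖) :=
    (real_inner_le_norm _ _).trans (mul_le_mul_of_nonneg_left (norm_cross_le_norm_mul_norm _ _)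
      (norm_nonneg _))
  have h2 := norm_mul_norm_le_sqrt_mul_balance ht a b
  calc ⟪v, cross a b⟫ ≤ ‖v‖ * (‖a‖ * ‖b‖) := h1
    _ ≤ ‖v‖ * (Real.sqrt (-t) * (‖b‖ ^ 2 + ‖a‖ ^ 2 / (4 * (-t)))) :=
        mul_le_mul_of_nonneg_left h2 (norm_nonneg _)
    _ = _ := by ring

/-- **An excess point is FAST**: if `(1+ε)(‖curl ω‖² + ‖ω‖²/(4(−t))) < ⟪V, ω × curl ω⟫` at `(t,x)`
then `1 + ε < √(−t)‖V(t,x)‖` (any real `ε`). [folklore] -/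
theorem fast_of_localBalance_excess {t ε : ℝ} (ht : t < 0) {x : EuclideanSpace ℝ (Fin 3)}
    (hx : (1 + ε) * (‖curl (curl (V t)) x‖ ^ 2 + ‖curl (V t) x‖ ^ 2 / (4 * (-t))) <
      ⟪V t x, cross (curl (V t) x) (curl (curl (V t)) x)⟫) :
    1 + ε < Real.sqrt (-t) * ‖V t x‖ := by
  have ht' : 0 < -t := neg_pos.2 ht
  set F : ℝ := ‖curl (curl (V t)) x‖ ^ 2 + ‖curl (V t) x‖ ^ 2 / (4 * (-t)) with hF
  have hF0 : 0 ≤ F := by positivity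
  have h := inner_lamb_le_speed_mul_balance ht (V t x) (curl (V t) x) (curl (curl (V t)) x)
  have hlt : (1 + ε) * F < Real.sqrt (-t) * ‖V t x‖ * F := hx.trans_le h
  -- `F > 0` (else both sides vanish) and divide
  have hFpos : 0 < F := by
    rcases hF0.lt_or_eq with h0 | h0
    · exact h0
    · rw [← h0, mul_zero, mul_zero] at hlt; exact absurd hlt (lt_irrefl _)
  exact lt_of_mul_lt_mul_right hlt hFpos.le

/-- **An excess point is CENTRAL**: with a Type-I envelope `‖V(t,x)‖ ≤ A/(‖x‖ + √(−t))` an excess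
point as above has `(1+ε)(‖x‖ + √(−t)) < A√(−t)` — it lies in the parabolic core
`‖x‖ < (A/(1+ε) − 1)√(−t)`, which is empty unless `A > 1 + ε`. [folklore] -/
theorem core_of_localBalance_excess {A t ε : ℝ} (hdec : HasTypeIDecay A V) (ht : t < 0)
    {x : EuclideanSpace ℝ (Fin 3)}
    (hx : (1 + ε) * (‖curl (curl (V t)) x‖ ^ 2 + ‖curl (V t) x‖ ^ 2 / (4 * (-t))) <
      ⟪V t x, cross (curl (V t) x) (curl (curl (V t)) x)⟫) :
    (1 + ε) * (‖x‖ + Real.sqrt (-t)) < A * Real.sqrt (-t) := by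
  have hfast := fast_of_localBalance_excess ht hx
  have hs : 0 < Real.sqrt (-t) := Real.sqrt_pos.2 (neg_pos.2 ht)
  have hden : 0 < ‖x‖ + Real.sqrt (-t) := by positivity
  have henv := hdec t ht x
  -- `(1+ε)(‖x‖+√(−t)) < √(−t)‖V‖(‖x‖+√(−t)) ≤ √(−t)·A`
  have h1 : Real.sqrt (-t) * ‖V t x‖ * (‖x‖ + Real.sqrt (-t)) ≤ Real.sqrt (-t) * A := by
    have := mul_le_mul_of_nonneg_left henv hden.le
    rw [mul_div_cancel₀ _ hden.ne'] at this
    calc Real.sqrt (-t) * ‖V t x‖ * (‖x‖ + Real.sqrt (-t))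
        = Real.sqrt (-t) * ((‖x‖ + Real.sqrt (-t)) * ‖V t x‖) := by ring
      _ ≤ Real.sqrt (-t) * A := mul_le_mul_of_nonneg_left this hs.le
  have h2 : (1 + ε) * (‖x‖ + Real.sqrt (-t)) < Real.sqrt (-t) * ‖V t x‖ * (‖x‖ + Real.sqrt (-t)) :=
    mul_lt_mul_of_pos_right hfast hden
  linarith

/-- **PORTRAIT: the local production excess of the critical element is FAST and CENTRAL.** For every
`A` there is `ε = ε(A) > 0` such that every KNSS-gauge Type-I field with `IsTypeIAncientMild C V`,
`C ≤ A`, `HasTypeIDecay A V`, SINGULAR at the apex, has a point `(t,x)`, `t < 0`, where the Lamb-form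
enstrophy production exceeds `(1+ε)×`(local dissipation + scaling density), the speed exceeds
`(1+ε)/√(−t)`, and `(1+ε)(‖x‖ + √(−t)) < A√(−t)`. [folklore energy method + KNSS compactness] -/
theorem localBalance_excess_in_fastCore_of_singular (A : ℝ) : ∃ ε : ℝ, 0 < ε ∧
    ∀ (C : ℝ) (V : ℝ → EuclideanSpace ℝ (Fin 3) → EuclideanSpace ℝ (Fin 3)),
      IsTypeIAncientMild C V → C ≤ A → HasTypeIDecay A V →
      (∀ r > 0, ∀ M : ℝ, ∃ t ∈ Ioo (-(r ^ 2)) (0 : ℝ),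
        ∃ x ∈ ball (0 : EuclideanSpace ℝ (Fin 3)) r, M < ‖V t x‖) →
      ∃ t : ℝ, t < 0 ∧ ∃ x : EuclideanSpace ℝ (Fin 3),
        (1 + ε) * (‖curl (curl (V t)) x‖ ^ 2 + ‖curl (V t) x‖ ^ 2 / (4 * (-t))) <
            ⟪V t x, cross (curl (V t) x) (curl (curl (V t)) x)⟫ ∧
          1 + ε < Real.sqrt (-t) * ‖V t x‖ ∧
          (1 + ε) * (‖x‖ + Real.sqrt (-t)) < A * Real.sqrt (-t) := by
  obtain ⟨ε, hε, h⟩ := localBalance_excess_of_singular A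
  refine ⟨ε, hε, fun C V hV hCA hdec hsing => ?_⟩
  obtain ⟨t, ht, x, hx⟩ := h C V hV hCA hdec hsing
  exact ⟨t, ht, x, hx, fast_of_localBalance_excess ht hx, core_of_localBalance_excess hdec ht hx⟩

/-- In particular **no enveloped member with `A ≤ 1` is singular** (the core is empty) — consistent
with the law-free threshold one on the enveloped class. [folklore] -/
theorem not_singular_of_envelope_le_one {A : ℝ} (hV : IsTypeIAncientMild C V) (hCA : C ≤ A)
    (hdec : HasTypeIDecay A V) (hA : A ≤ 1) :
    ¬ (∀ r > 0, ∀ M : ℝ, ∃ t ∈ Ioo (-(r ^ 2)) (0 : ℝ),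
        ∃ x ∈ ball (0 : EuclideanSpace ℝ (Fin 3)) r, M < ‖V t x‖) := by
  intro hsing
  obtain ⟨ε, hε, h⟩ := localBalance_excess_in_fastCore_of_singular A
  obtain ⟨t, ht, x, -, -, hcore⟩ := h C V hV hCA hdec hsing
  have hs : 0 < Real.sqrt (-t) := Real.sqrt_pos.2 (neg_pos.2 ht)
  have : (1 + ε) * (‖x‖ + Real.sqrt (-t)) ≥ 1 * Real.sqrt (-t) := by
    nlinarith [norm_nonneg x]
  nlinarith

end Summit.NavierStokesRegularity.NavierStokesRegularity.Theorems.FiniteDissipationLiouville.LocalBalance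

end
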